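import Literature.Computability.Complexity.CodeFPArith
import HarnessLib

/-!
# The maximal-order loop of a pure cubic field in the typed polynomial-time algebra `CodeFP`

Topic `Computability/Cryptography`; the programming layer of the computation of the maximal
order `𝓞_K` of `K = ℚ(∛(ab²))` as a canonical lattice code
(`NumberTheory/CubicFields/PureCubicMaximalOrderCode.lean`): starting from the code of Dedekind's
order `ℤ[θ, θ₂]`, a FIXED list of `26` candidate element codes `e` is folded through
`c ↦ if test e then latAddGen c e else c`, where the integrality test of a candidate
`ν = (x + yθ + zθ₂)/3` is exact integer arithmetic on the code `m` of `ν²` and the code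
`(num, den)` of `N(ν)`: `2·den(m) ∣ x²·den(m) − 3·m₁` and `den ∣ num`, divisibility being tested
division-free as `N − D·(N/D) = 0`. Theorem-only file, no named facts:

* `codeFP_foldl_const` — a left fold over a CONSTANT list with a context is `|list|` compositions
  (no length-bound bookkeeping, unlike `CodeFP.foldl` over an input list);
* `codeFP_dvdTest`, `codeFP_intTestCore`, `codeFP_intTest` — the integrality test, given programs
  for the product and the norm of element codes;
* `codeFP_satStep`, **`codeFP_orderLoop`** — one saturation step and the whole loop, given in
  addition a program for "lattice + one generator".

Codes: context `(a, b)` by `pairE natE natE`, element codes `(x, y, z, den)` by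
`pairE intE (pairE intE (pairE intE natE))`, lattice codes `(den, [h11, …, h33])` by
`pairE natE (rawE intE)`.

## References

* S. Arora, B. Barak, *Computational Complexity: A Modern Approach*, CUP 2009, §1.2–1.3
  (closure of polynomial time under composition). [AroraBarak2009]
* H. Cohen, *A Course in Computational Algebraic Number Theory*, GTM 138, Springer 1993, §6.4.5,
  Algorithm 6.1.8. [Cohen1993]
-/

namespace Literature.Computability.Cryptography

namespace PureCubicOrderFP

open Literature.Computability.Complexity Literature.Computability.Complexity.CodeFP

/-! ### Folding over a constant list -/

/-- **A left fold over a constant list, with a context, is computed on codes** when its step is: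
`(s, c) ↦ L.foldl (fun c e => S (s, (c, e))) c` is `|L|` compositions of the step with constant
items. [cite: AroraBarak2009, §1.3 (composition of polynomial-time functions)] -/
theorem codeFP_foldl_const {σ β γ : Type} {eσ : σ → List Bool} {eβ : β → List Bool}
    {eγ : γ → List Bool} {S : σ × (β × γ) → β} (hS : CodeFP (pairE eσ (pairE eβ eγ)) eβ S) :
    ∀ L : List γ, CodeFP (pairE eσ eβ) eβ (fun p => L.foldl (fun c e => S (p.1, (c, e))) p.2)
  | [] => (snd eσ eβ).congr fun _ => rfl
  | e :: L => ((codeFP_foldl_const hS L).comp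
      ((fst eσ eβ).pair (hS.comp ((fst eσ eβ).pair ((snd eσ eβ).pair (const _ e)))))).congr
        fun _ => rfl

/-! ### The integrality test -/

/-- The division-free divisibility test `(N, D) ↦ [N − D·(N/D) = 0]`. [folklore] -/
theorem codeFP_dvdTest :
    CodeFP (pairE intE intE) bitE (fun q => decide (q.1 - q.2 * (q.1 / q.2) = 0)) :=
  (intEq.comp ((intSub.comp ((fst _ _).pair (intMul.comp ((snd _ _).pair intEDiv)))).pair
    (const _ (0 : ℤ))) :)

/-- **The integrality test on `(x, m, (num, den))`** — `x` the first coordinate of a candidate of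
denominator `3`, `m` the code of its square, `(num, den)` its norm:
`[2·den(m) ∣ x²·den(m) − 3·m₁] ∧ [den ∣ num]`. [cite: Cohen1993, §6.4.5] -/
theorem codeFP_intTestCore :
    CodeFP (pairE intE (pairE (pairE intE (pairE intE (pairE intE natE))) (pairE intE natE))) bitE
      (fun t => decide (t.1 * t.1 * t.2.1.2.2.2 - 3 * t.2.1.1 -
            2 * (t.2.1.2.2.2 : ℤ) *
              ((t.1 * t.1 * t.2.1.2.2.2 - 3 * t.2.1.1) / (2 * (t.2.1.2.2.2 : ℤ))) = 0) &&
          decide (t.2.2.1 - (t.2.2.2 : ℤ) * (t.2.2.1 / (t.2.2.2 : ℤ)) = 0)) := by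
  have hx : CodeFP (pairE intE (pairE (pairE intE (pairE intE (pairE intE natE)))
      (pairE intE natE))) intE (fun t => t.1) := fst _ _
  have hm1 : CodeFP (pairE intE (pairE (pairE intE (pairE intE (pairE intE natE)))
      (pairE intE natE))) intE (fun t => t.2.1.1) := (snd _ _).fst'.fst'
  have hmd : CodeFP (pairE intE (pairE (pairE intE (pairE intE (pairE intE natE)))
      (pairE intE natE))) intE (fun t => (t.2.1.2.2.2 : ℤ)) :=
    (intOfNat.comp (snd _ _).fst'.snd'.snd'.snd' :)
  have hn : CodeFP (pairE intE (pairE (pairE intE (pairE intE (pairE intE natE)))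
      (pairE intE natE))) intE (fun t => t.2.2.1) := (snd _ _).snd'.fst'
  have hd : CodeFP (pairE intE (pairE (pairE intE (pairE intE (pairE intE natE)))
      (pairE intE natE))) intE (fun t => (t.2.2.2 : ℤ)) := (intOfNat.comp (snd _ _).snd'.snd' :)
  have hN : CodeFP (pairE intE (pairE (pairE intE (pairE intE (pairE intE natE)))
      (pairE intE natE))) intE (fun t => t.1 * t.1 * t.2.1.2.2.2 - 3 * t.2.1.1) :=
    (intSub.comp ((intMul.comp ((intMul.comp (hx.pair hx)).pair hmd)).pair
      (intMul.comp ((const _ (3 : ℤ)).pair hm1))) :)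
  have hD : CodeFP (pairE intE (pairE (pairE intE (pairE intE (pairE intE natE)))
      (pairE intE natE))) intE (fun t => 2 * (t.2.1.2.2.2 : ℤ)) :=
    (intMul.comp ((const _ (2 : ℤ)).pair hmd) :)
  exact ((codeFP_dvdTest.comp (hN.pair hD)).and (codeFP_dvdTest.comp (hn.pair hd))).congr
    fun _ => rfl

/-- **The integrality test of a candidate code** `e` in context `(a, b)`, given programs `mulE` for
the product and `normE` for the norm of element codes: the core test on
`(x, mulE ((a,b),(e,e)), normE ((a,b),e))`. [cite: Cohen1993, §6.4.5] -/
theorem codeFP_intTest {mulE : (ℕ × ℕ) × ((ℤ × ℤ × ℤ × ℕ) × (ℤ × ℤ × ℤ × ℕ)) → ℤ × ℤ × ℤ × ℕ}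
    {normE : (ℕ × ℕ) × (ℤ × ℤ × ℤ × ℕ) → ℤ × ℕ}
    (hmul : CodeFP (pairE (pairE natE natE) (pairE (pairE intE (pairE intE (pairE intE natE)))
      (pairE intE (pairE intE (pairE intE natE)))))
      (pairE intE (pairE intE (pairE intE natE))) mulE)
    (hnorm : CodeFP (pairE (pairE natE natE) (pairE intE (pairE intE (pairE intE natE))))
      (pairE intE natE) normE) :
    CodeFP (pairE (pairE natE natE) (pairE intE (pairE intE (pairE intE natE)))) bitE (fun p =>
      (fun t : ℤ × ((ℤ × ℤ × ℤ × ℕ) × (ℤ × ℕ)) =>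
          decide (t.1 * t.1 * t.2.1.2.2.2 - 3 * t.2.1.1 -
            2 * (t.2.1.2.2.2 : ℤ) *
              ((t.1 * t.1 * t.2.1.2.2.2 - 3 * t.2.1.1) / (2 * (t.2.1.2.2.2 : ℤ))) = 0) &&
          decide (t.2.2.1 - (t.2.2.2 : ℤ) * (t.2.2.1 / (t.2.2.2 : ℤ)) = 0))
        (p.2.1, mulE (p.1, (p.2, p.2)), normE p)) :=
  codeFP_intTestCore.comp ((snd _ _).fst'.pair
    ((hmul.comp ((fst _ _).pair ((snd _ _).pair (snd _ _)))).pair hnorm))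

/-! ### The saturation step and the loop -/

/-- **One saturation step**
`((a,b), (c, e)) ↦ if test ((a,b), e) then latAddGen ((a,b),(c,e)) else c` is computed on codes
when the test and `latAddGen` are. [cite: AroraBarak2009, §1.3] -/
theorem codeFP_satStep {test : (ℕ × ℕ) × (ℤ × ℤ × ℤ × ℕ) → Bool}
    {latAddGen : (ℕ × ℕ) × ((ℕ × List ℤ) × (ℤ × ℤ × ℤ × ℕ)) → ℕ × List ℤ}
    (htest : CodeFP (pairE (pairE natE natE) (pairE intE (pairE intE (pairE intE natE)))) bitE test)
    (hadd : CodeFP (pairE (pairE natE natE) (pairE (pairE natE (rawE intE))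
      (pairE intE (pairE intE (pairE intE natE))))) (pairE natE (rawE intE)) latAddGen) :
    CodeFP (pairE (pairE natE natE) (pairE (pairE natE (rawE intE))
      (pairE intE (pairE intE (pairE intE natE))))) (pairE natE (rawE intE))
      (fun q => if test (q.1, q.2.2) then latAddGen q else q.2.1) :=
  ((htest.comp ((fst _ _).pair (snd _ _).snd')).ite (hadd.comp (CodeFP.id _)) (snd _ _).fst').congr
    fun _ => rfl

/-- **The saturation loop over a constant candidate list** from a constant start code is computed
on codes (context `(a, b)` in, lattice code out). [cite: AroraBarak2009, §1.3] -/
theorem codeFP_orderLoop {S : (ℕ × ℕ) × ((ℕ × List ℤ) × (ℤ × ℤ × ℤ × ℕ)) → ℕ × List ℤ}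
    (hS : CodeFP (pairE (pairE natE natE) (pairE (pairE natE (rawE intE))
      (pairE intE (pairE intE (pairE intE natE))))) (pairE natE (rawE intE)) S)
    (L : List (ℤ × ℤ × ℤ × ℕ)) (c₀ : ℕ × List ℤ) :
    CodeFP (pairE natE natE) (pairE natE (rawE intE))
      (fun ab => L.foldl (fun c e => S (ab, (c, e))) c₀) :=
  ((codeFP_foldl_const hS L).comp ((CodeFP.id (pairE natE natE)).pair (const _ c₀))).congr
    fun _ => rfl

end PureCubicOrderFP

end Literature.Computability.Cryptography
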